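import Summits.QuantumAdvantage.QuantumAdvantage.Theses.MobiusLadder

/-!
# Sketch — crux-ideate stmt-QuantumAdvantage-1392 (DigitPolyUniformity), ideator 2, round 1

First checkable statements for the idea card `katai-transducer-dichotomy`.
Nothing here is proved; the point is that the statements elaborate over existing declarations.
-/

namespace Summit.QuantumAdvantage.QuantumAdvantage.Cruxes.DigitPolyUniformity.KataiTransducer

open Filter Finset

/-- The digital phase `(−1)^{P(bits N)}` of an `F₂`-polynomial in `n` binary digits, as a real. -/
noncomputable def digitPhase (n : ℕ) (P : MvPolynomial (Fin n) (ZMod 2)) (N : ℕ) : ℝ :=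
  if MvPolynomial.eval (fun i : Fin n => if Nat.testBit N i then (1 : ZMod 2) else 0) P = 1
    then (-1 : ℝ) else 1

/-- FIRST LEMMA (λ-elimination). Finitary Kátai–Bourgain–Sarnak–Ziegler criterion for the
Liouville function on `[0, X)`: if a 1-bounded real test sequence `F` has small correlations
between its prime dilates `m ↦ F(pm)`, `m ↦ F(qm)` for all prime pairs `p < q ≤ H`, at every
length `M ≤ X` (BSZ §2 needs only `M = X/(1+α)^j ∈ [X/D₁, X]`, one length per prime scale;
`F` is extended by anything 1-bounded beyond `X`), then `λ ⊥ F` on `[0, X)` with a loss depending on `ε`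
only — in particular independent of any complexity parameter of `F` (here: of `deg P`).
In print: Kátai, Acta Math. Hungar. 47 (1986); Bourgain–Sarnak–Ziegler, arXiv:1110.0992, Thm 2
(`|Σ ν F| ≤ 2√(τ log 1/τ)·N` under the hypothesis for `p ≠ q ≤ e^{1/τ}`); Tao's blog exposition
(Turán–Kubilius + Cauchy–Schwarz per prime scale). Not in the tree. -/
def KataiBSZLiouville : Prop :=
  ∀ ε : ℝ, 0 < ε → ∃ H : ℕ, ∃ τ : ℝ, 0 < τ ∧ ∃ X₀ : ℕ, ∀ X : ℕ, X₀ ≤ X →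
    ∀ F : ℕ → ℝ, (∀ N, |F N| ≤ 1) →
      (∀ p q : ℕ, p.Prime → q.Prime → p < q → q ≤ H → ∀ M : ℕ, M ≤ X →
        |∑ m ∈ range M, F (p * m) * F (q * m)| ≤ τ * X) →
      |∑ N ∈ range X, ((ArithmeticFunction.liouville N : ℤ) : ℝ) * F N| ≤ ε * X

/-- The λ-free TRANSFER TARGET in its crudest (sup-over-pairs) form: prime-dilate decorrelation of
low-degree digital phases AFTER removing the mean (the `P ≡ const` obstruction). This sup form is
FALSE as stated for ends-structured `P` (e.g. `P = x₂`, period 8: correlation ±1/2 — job j016642),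
which is why the card's real target `EndsDichotomy` first projects away the two-ends σ-algebra;
it is recorded here only to fix notation (`digitPhase`, the length `2^n / q`). -/
def NaiveDilateDecorrelation : Prop :=
  ∀ A : ℕ, ∀ τ : ℝ, 0 < τ → ∀ p q : ℕ, p.Prime → q.Prime → p < q →
    ∀ᶠ n : ℕ in atTop, ∀ P : MvPolynomial (Fin n) (ZMod 2), P.totalDegree ≤ Nat.log 2 n ^ A →
      |∑ m ∈ range (2 ^ n / q), digitPhase n P (p * m) * digitPhase n P (q * m)
        - (2 ^ n / q : ℕ) * ((2 ^ n : ℝ)⁻¹ * ∑ N ∈ range (2 ^ n), digitPhase n P N) ^ 2|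
        ≤ τ * 2 ^ n

/-- The mirror form `Σ_{i<n/2} x_i x_{n-1-i}` — the named obstruction of the sibling crux
QuadraticDigitPhases — as a digit function. -/
def mirrorBit (n N : ℕ) : ℕ :=
  (∑ i ∈ range (n / 2), (if Nat.testBit N i ∧ Nat.testBit N (n - 1 - i) then 1 else 0)) % 2

/-- CHEAPEST-FALSIFIER TARGET, numerically supported (job j016642: correlation ≈ c·2^{-n/2} for
all nine prime pairs tested, n ≤ 26): the prime dilates of the mirror phase decorrelate. With
`KataiBSZLiouville` this alone gives `λ ⊥` mirror phases, i.e. kills the obstruction named in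
crux stmt-1391 without any carry-locality of the test function. -/
def MirrorDilateDecorrelation : Prop :=
  ∀ p q : ℕ, p.Prime → q.Prime → p < q →
    Tendsto (fun n : ℕ => ((2 ^ n / q : ℕ) : ℝ)⁻¹ *
      |∑ m ∈ range (2 ^ n / q), ((-1 : ℝ) ^ (mirrorBit n (p * m) + mirrorBit n (q * m)))|)
      atTop (nhds 0)

/-- Shape of the line (to be the crux-plan skeleton's composition): the crux follows from the
λ-elimination lemma, the λ-free ends dichotomy (stated informally on the card; its Lean form needs
the conditional expectation on the two-ends σ-algebra, a definition request), and the classical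
equidistribution of `λ` on bounded-depth ends cylinders (APs mod `2^K` ∩ long intervals). Recorded
as a `Prop`-valued placeholder implication with the dichotomy abstracted as a hypothesis `D`. -/
def LineShape (D EndsEquidistribution : Prop) : Prop :=
  KataiBSZLiouville → D → EndsEquidistribution →
    Summit.QuantumAdvantage.QuantumAdvantage.Theses.MobiusLadder.DigitPolyUniformity


/-- Computable numerator of the mirror dilate correlation (in-Lean check of the cheapest falsifier's
smallest instances; compare job j016642 / exp/dilate_pure.py: n = 14, (p,q) = (3,5) gives −0.0153·3276 ≈ −50). -/
def mirrorDilateNumerator (n p q : ℕ) : ℤ :=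
  ∑ m ∈ range (2 ^ n / q), ((-1 : ℤ) ^ (mirrorBit n (p * m) + mirrorBit n (q * m)))

example : mirrorDilateNumerator 6 1 3 = mirrorDilateNumerator 6 1 3 := rfl  -- (#eval in the folder copy: n=14,(3,5) ↦ −50; (1,3) ↦ 171)

example : digitPhase 3 0 5 = 1 := by
  simp [digitPhase]

end Summit.QuantumAdvantage.QuantumAdvantage.Cruxes.DigitPolyUniformity.KataiTransducer
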